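import Mathlib
import Literature.Computability.Complexity.SymmetricCircuit
import Literature.Computability.Complexity.CircuitComposition
import Literature.Computability.Complexity.NegationElimination
import Literature.Computability.Complexity.CircuitRestriction
import Literature.Computability.Complexity.BlockTuples
import Summits.PneNP.PneNP.Theorems.SymmetryBudgetWindowBarrierStubHeaderHardwiring
/-!
# Monadic guesses are affordable for square-symmetric circuits — layout and evaluation
(helper for crux `SymmetryBudget.WindowBarrier`, item stmt-PneNP-2145, line
`canonical-form-completeness`, stub S4 / its pure core (★))

MATERIALISATION LEMMA (the formal content of "subset-indexed brute force", the route's and the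
disprover's reason why CFI-type witnesses die in the window). Let `C` be a threshold circuit whose
inputs are the entries `(u, v)` of a `g × g` matrix TOGETHER WITH `g` point inputs `u` (a guessed
subset `S ⊆ Fin g`, entered as its indicator), symmetric under `Sym(Fin g)` acting on both sorts.
Then `x ↦ [∃ S ⊆ Fin g, C(x, 1_S)]` is computed by a `Sym(Fin g)`-symmetric (square-symmetric)
circuit on the matrix inputs alone with `2^g · |C| + 3` gates: two constant gates, one relocated
copy of `C` per subset `S` with the point input `u` hard-wired to the constant `[u ∈ S]`, and a
final gate (`∨`, or any `tcBasis` gate such as `MAJ` with constant padding) over the `2^g` copy outputs (this file: the layout `exists_layout`, the block permutation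
`exists_blockPerm`, and the evaluation `eval_layout`; the symmetry and the theorem are in
`SymmetryBudgetWindowBarrierMonadicGuess.lean`). In the window `g = ⌊log₂ m⌋` this is `poly(m)`:
one monadic second-order guess over the free part is affordable, so every property of the free part
of the form "some vertex subset passes a symmetric poly-size test" (CFI global sections, bounded-
domain vertex CSPs, colour classes, Held–Karp-type tables) is symmetric-cheap, and every fooling
pair for S4/(★) must agree on all of them. Folklore in the CPT literature (Dawar–Richerby–Rossman
2008; Pakusa–Schalthöfer–Selman 2016: CFI over logarithmic colour classes is CPT-definable).
-/
-- `Summit.PneNP.PneNP.…` duplicates `PneNP` BY DESIGN (single-problem summit).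
set_option linter.dupNamespace false

namespace Summit.PneNP.PneNP.Theorems

open Literature.Computability.Complexity Literature.Computability.Complexity.GateList
open scoped Classical

namespace Monadic

/-! ### Block arithmetic -/

/-- Quotient of a block index. -/
theorem div_lt_of_lt_mul {N c v : ℕ} (h : v < N * c) : v / c < N := by
  rcases Nat.eq_zero_or_pos c with rfl | hc
  · simp at h
  · exact Nat.div_lt_of_lt_mul (by rwa [Nat.mul_comm] at h)

/-- Remainder of a block index. -/
theorem mod_lt_of_lt_mul {N c v : ℕ} (h : v < N * c) : v % c < c := by
  rcases Nat.eq_zero_or_pos c with rfl | hc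
  · simp at h
  · exact Nat.mod_lt _ hc

/-! ### The block permutation `id₂ ⊕ (π ≀ σ) ⊕ id₁` -/

/-- The index map of the block permutation: the two constants are fixed, block `i`, position `j`
goes to block `π i`, position `σ j`, the final gate is fixed (written with the total index maps
`relabelGate`, identity out of range). -/
theorem blockMap_lt {N c : ℕ} (π : Equiv.Perm (Fin N)) (σ : Equiv.Perm (Fin c)) {v : ℕ}
    (hv : v < 2 + N * c + 1) :
    (if v < 2 then v else if v < 2 + N * c then
      2 + Circuit.relabelGate π ((v - 2) / c) * c + Circuit.relabelGate σ ((v - 2) % c) else v) <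
      2 + N * c + 1 := by
  split_ifs with h1 h2
  · omega
  · have hlt : v - 2 < N * c := by omega
    have hi := div_lt_of_lt_mul hlt
    have hj := mod_lt_of_lt_mul hlt
    rw [Circuit.relabelGate_of_lt π hi, Circuit.relabelGate_of_lt σ hj]
    have := blockIndex_lt (σ ⟨(v - 2) % c, hj⟩).2 (π ⟨(v - 2) / c, hi⟩).2
    omega
  · exact hv

/-- The block index map of `(π.symm, σ.symm)` undoes that of `(π, σ)`. -/
theorem blockMap_inv {N c : ℕ} (π : Equiv.Perm (Fin N)) (σ : Equiv.Perm (Fin c)) (v : ℕ) :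
    (fun w : ℕ => if w < 2 then w else if w < 2 + N * c then
      2 + Circuit.relabelGate π.symm ((w - 2) / c) * c + Circuit.relabelGate σ.symm ((w - 2) % c)
      else w)
    (if v < 2 then v else if v < 2 + N * c then
      2 + Circuit.relabelGate π ((v - 2) / c) * c + Circuit.relabelGate σ ((v - 2) % c) else v) = v := by
  dsimp only
  by_cases h1 : v < 2
  · rw [if_pos h1, if_pos h1]
  · rw [if_neg h1]
    by_cases h2 : v < 2 + N * c
    · rw [if_pos h2]
      have hlt : v - 2 < N * c := by omega
      have hi := div_lt_of_lt_mul hlt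
      have hj := mod_lt_of_lt_mul hlt
      rw [Circuit.relabelGate_of_lt π hi, Circuit.relabelGate_of_lt σ hj]
      have hlt' := blockIndex_lt (σ ⟨(v - 2) % c, hj⟩).2 (π ⟨(v - 2) / c, hi⟩).2
      have h3 : ¬ 2 + (π ⟨(v - 2) / c, hi⟩ : ℕ) * c + (σ ⟨(v - 2) % c, hj⟩ : ℕ) < 2 := by omega
      have h4 : 2 + (π ⟨(v - 2) / c, hi⟩ : ℕ) * c + (σ ⟨(v - 2) % c, hj⟩ : ℕ) < 2 + N * c := by
        omega
      rw [if_neg h3, if_pos h4]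
      have h5 : 2 + (π ⟨(v - 2) / c, hi⟩ : ℕ) * c + (σ ⟨(v - 2) % c, hj⟩ : ℕ) - 2 =
          (π ⟨(v - 2) / c, hi⟩ : ℕ) * c + (σ ⟨(v - 2) % c, hj⟩ : ℕ) := by omega
      rw [h5, (div_mod_block (k := (π ⟨(v - 2) / c, hi⟩ : ℕ)) (σ ⟨(v - 2) % c, hj⟩).2).1,
        (div_mod_block (k := (π ⟨(v - 2) / c, hi⟩ : ℕ)) (σ ⟨(v - 2) % c, hj⟩).2).2,
        Circuit.relabelGate_of_lt π.symm (π ⟨(v - 2) / c, hi⟩).2,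
        Circuit.relabelGate_of_lt σ.symm (σ ⟨(v - 2) % c, hj⟩).2, Fin.eta, Fin.eta,
        Equiv.symm_apply_apply, Equiv.symm_apply_apply]
      have := Nat.div_add_mod' (v - 2) c
      simp only
      omega
    · rw [if_neg h2, if_neg h1, if_neg h2]

/-- **The block permutation.** For permutations `π` of the `N` blocks and `σ` of the `c` positions
of a block there is a permutation `τ` of `Fin (2 + N·c + 1)` fixing `0, 1` and the last index and
sending block `i`, position `j` to block `π i`, position `σ j`. -/
theorem exists_blockPerm (N c : ℕ) (π : Equiv.Perm (Fin N)) (σ : Equiv.Perm (Fin c)) :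
    ∃ τ : Equiv.Perm (Fin (2 + N * c + 1)), ∀ v : ℕ, Circuit.relabelGate τ v =
      if v < 2 then v else if v < 2 + N * c then
        2 + Circuit.relabelGate π ((v - 2) / c) * c + Circuit.relabelGate σ ((v - 2) % c) else v := by
  refine ⟨⟨fun v => ⟨_, blockMap_lt π σ v.2⟩, fun v => ⟨_, blockMap_lt π.symm σ.symm v.2⟩,
    fun v => Fin.ext (blockMap_inv π σ v),
    fun v => Fin.ext (by simpa only [Equiv.symm_symm] using blockMap_inv π.symm σ.symm v)⟩,
    fun v => ?_⟩
  by_cases hv : v < 2 + N * c + 1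
  · rw [Circuit.relabelGate_of_lt _ hv]
    rfl
  · have h1 : ¬ v < 2 := by omega
    have h2 : ¬ v < 2 + N * c := by omega
    rw [Circuit.relabelGate_of_le _ (not_lt.1 hv), if_neg h1, if_neg h2]

/-! ### The layout: constants, one relocated copy of `C` per block, a final `∨` -/

variable {g : ℕ}

/-- **The subset wirings.** Block `i` (subset `e i`) rewires the matrix input `(u,v)` of the
template to the matrix input `(u,v)` and the point input `u` to the constant gate `0` (value
`true`) if `u ∈ e i`, to the constant gate `1` (value `false`) otherwise. -/
theorem exists_subsetWire (N : ℕ) (e : Fin N → Finset (Fin g)) :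
    ∃ φ : Fin N → ((Fin g × Fin g) ⊕ Fin g) → (Fin g × Fin g) ⊕ ℕ,
      (∀ i, WiresOK 2 (φ i)) ∧ (∀ i p, φ i (Sum.inl p) = Sum.inl p) ∧
      (∀ i u, φ i (Sum.inr u) = Sum.inr (if u ∈ e i then 0 else 1)) := by
  refine ⟨fun i w => Sum.elim (fun p => Sum.inl p) (fun u => Sum.inr (if u ∈ e i then 0 else 1)) w,
    fun i => ?_, fun _ _ => rfl, fun _ _ => rfl⟩
  rintro (p | u) k hk
  · cases hk
  · simp only [Sum.elim_inr, Sum.inr.injEq] at hk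
    split_ifs at hk <;> omega

/-- Every relocated block gate only reads earlier positions. -/
theorem gateOK_block (N : ℕ) (C : Circuit ((Fin g × Fin g) ⊕ Fin g))
    (φ : Fin N → ((Fin g × Fin g) ⊕ Fin g) → (Fin g × Fin g) ⊕ ℕ) (hφ : ∀ i, WiresOK 2 (φ i))
    (v : ℕ) (hv : v < N * C.gates.length) :
    GateOK (2 + v) (reloc (φ ⟨v / C.gates.length, div_lt_of_lt_mul hv⟩)
      (2 + (v / C.gates.length) * C.gates.length)
      (C.gates[v % C.gates.length]'(mod_lt_of_lt_mul hv))) := by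
  intro a k hk
  simp only [reloc] at hk
  cases hw : (C.gates[v % C.gates.length]'(mod_lt_of_lt_mul hv)).args a with
  | inl w =>
    rw [hw] at hk
    simp only [shiftWire] at hk
    have := hφ _ w k hk
    omega
  | inr k' =>
    rw [hw] at hk
    simp only [shiftWire, Sum.inr.injEq] at hk
    have hk' : k' < v % C.gates.length := C.wf _ (mod_lt_of_lt_mul hv) a k' hw
    have := Nat.div_add_mod' v C.gates.length
    omega

/-- **The final gate** of the layout: `N` block-output wires followed by `A` constant wires
(`κ i < 2` selects the constant gate). It only reads earlier positions. -/
theorem gateOK_finalGate (N A : ℕ) (C : Circuit ((Fin g × Fin g) ⊕ Fin g))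
    (φ : Fin N → ((Fin g × Fin g) ⊕ Fin g) → (Fin g × Fin g) ⊕ ℕ) (hφ : ∀ i, WiresOK 2 (φ i))
    (op : (Fin (N + A) → Bool) → Bool) (κ : ℕ → ℕ) (hκ : ∀ i, κ i < 2) :
    GateOK (2 + N * C.gates.length)
      (⟨N + A, op, fun k => if h : (k : ℕ) < N then
          shiftWire (φ ⟨k, h⟩) (2 + (k : ℕ) * C.gates.length) C.output
        else Sum.inr (κ (k - N))⟩ : Gate (Fin g × Fin g)) := by
  intro a k hk
  dsimp only at hk
  by_cases ha : (a : ℕ) < N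
  · rw [dif_pos ha] at hk
    cases hw : C.output with
    | inl w =>
      rw [hw] at hk
      simp only [shiftWire] at hk
      have := hφ _ w k hk
      omega
    | inr k' =>
      rw [hw] at hk
      simp only [shiftWire, Sum.inr.injEq] at hk
      have hk' : k' < C.gates.length := C.wf_output k' hw
      have := blockIndex_lt hk' ha
      omega
  · rw [dif_neg ha] at hk
    simp only [Sum.inr.injEq] at hk
    have := hκ (a - N)
    omega

/-- **The layout exists as a `Circuit`.** Gates: the prefix `pre` (two wireless gates), then for
`v < N·c` the gate `C.gates[v % c]` of block `v / c` relocated behind `2 + (v/c)·c` gates along the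
block's wiring, then one `∨_N` gate reading the `N` block outputs; output = that `∨` gate. -/
theorem exists_layout (N A : ℕ) (C : Circuit ((Fin g × Fin g) ⊕ Fin g))
    (pre : List (Gate (Fin g × Fin g))) (hpreL : pre.length = 2) (hpreWF : WF pre)
    (φ : Fin N → ((Fin g × Fin g) ⊕ Fin g) → (Fin g × Fin g) ⊕ ℕ) (hφ : ∀ i, WiresOK 2 (φ i))
    (op : (Fin (N + A) → Bool) → Bool) (κ : ℕ → ℕ) (hκ : ∀ i, κ i < 2) :
    ∃ D : Circuit (Fin g × Fin g),
      D.gates = pre ++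
        (List.ofFn fun v : Fin (N * C.gates.length) =>
          reloc (φ ⟨v / C.gates.length, div_lt_of_lt_mul v.2⟩) (2 + (v / C.gates.length) * C.gates.length)
            (C.gates[(v : ℕ) % C.gates.length]'(mod_lt_of_lt_mul v.2))) ++
        [⟨N + A, op, fun k => if h : (k : ℕ) < N then
            shiftWire (φ ⟨k, h⟩) (2 + (k : ℕ) * C.gates.length) C.output
          else Sum.inr (κ (k - N))⟩] ∧
      D.output = Sum.inr (2 + N * C.gates.length) := by
  have hwf : WF (pre ++
        (List.ofFn fun v : Fin (N * C.gates.length) =>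
          reloc (φ ⟨v / C.gates.length, div_lt_of_lt_mul v.2⟩) (2 + (v / C.gates.length) * C.gates.length)
            (C.gates[(v : ℕ) % C.gates.length]'(mod_lt_of_lt_mul v.2))) ++
        [⟨N + A, op, fun k => if h : (k : ℕ) < N then
            shiftWire (φ ⟨k, h⟩) (2 + (k : ℕ) * C.gates.length) C.output
          else Sum.inr (κ (k - N))⟩]) := by
    refine (hpreWF.append ?_).append ?_
    · intro j q hq
      obtain ⟨hjl, hq'⟩ := List.getElem?_eq_some_iff.1 hq
      rw [List.length_ofFn] at hjl
      rw [List.getElem_ofFn] at hq'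
      subst hq'
      rw [hpreL]
      exact gateOK_block N C φ hφ j hjl
    · intro j q hq
      obtain ⟨rfl, rfl⟩ : j = 0 ∧ (⟨N + A, op, fun k => if h : (k : ℕ) < N then
            shiftWire (φ ⟨k, h⟩) (2 + (k : ℕ) * C.gates.length) C.output
          else Sum.inr (κ (k - N))⟩ : Gate (Fin g × Fin g)) = q := by
        simpa [List.getElem?_singleton] using hq
      simp only [List.length_append, List.length_ofFn, hpreL, Nat.add_zero]
      exact gateOK_finalGate N A C φ hφ op κ hκ
  refine ⟨toCircuit _ (Sum.inr (2 + N * C.gates.length)) hwf (fun k hk => ?_), rfl, rfl⟩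
  simp only [Sum.inr.injEq] at hk
  subst hk
  simp [hpreL]


/-! ### Indexing into the layout -/

section Layout

variable {g N A : ℕ} {C : Circuit ((Fin g × Fin g) ⊕ Fin g)} {pre : List (Gate (Fin g × Fin g))}
  {φ : Fin N → ((Fin g × Fin g) ⊕ Fin g) → (Fin g × Fin g) ⊕ ℕ} {D : Circuit (Fin g × Fin g)}
  {op : (Fin (N + A) → Bool) → Bool} {κ : ℕ → ℕ}

/-- Length of the layout. -/
theorem layout_length
    (hDg : D.gates = pre ++
      (List.ofFn fun v : Fin (N * C.gates.length) =>
        reloc (φ ⟨v / C.gates.length, div_lt_of_lt_mul v.2⟩) (2 + (v / C.gates.length) * C.gates.length)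
          (C.gates[(v : ℕ) % C.gates.length]'(mod_lt_of_lt_mul v.2))) ++
      [⟨N + A, op, fun k => if h : (k : ℕ) < N then
          shiftWire (φ ⟨k, h⟩) (2 + (k : ℕ) * C.gates.length) C.output
        else Sum.inr (κ (k - N))⟩]) (hpreL : pre.length = 2) :
    D.gates.length = 2 + N * C.gates.length + 1 := by
  rw [hDg]
  simp only [List.length_append, List.length_ofFn, List.length_singleton, hpreL]

/-- The prefix gates of the layout. -/
theorem layout_getElem_pre
    (hDg : D.gates = pre ++
      (List.ofFn fun v : Fin (N * C.gates.length) =>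
        reloc (φ ⟨v / C.gates.length, div_lt_of_lt_mul v.2⟩) (2 + (v / C.gates.length) * C.gates.length)
          (C.gates[(v : ℕ) % C.gates.length]'(mod_lt_of_lt_mul v.2))) ++
      [⟨N + A, op, fun k => if h : (k : ℕ) < N then
          shiftWire (φ ⟨k, h⟩) (2 + (k : ℕ) * C.gates.length) C.output
        else Sum.inr (κ (k - N))⟩]) (hpreL : pre.length = 2) {v : ℕ} (hv : v < 2)
    (hv' : v < D.gates.length) : D.gates[v] = pre[v]'(by omega) := by
  simp only [hDg]
  rw [List.getElem_append_left (by simp [hpreL]; omega), List.getElem_append_left]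

/-- The block gates of the layout: block `i`, position `j` sits at `2 + i·c + j`. -/
theorem layout_getElem_block
    (hDg : D.gates = pre ++
      (List.ofFn fun v : Fin (N * C.gates.length) =>
        reloc (φ ⟨v / C.gates.length, div_lt_of_lt_mul v.2⟩) (2 + (v / C.gates.length) * C.gates.length)
          (C.gates[(v : ℕ) % C.gates.length]'(mod_lt_of_lt_mul v.2))) ++
      [⟨N + A, op, fun k => if h : (k : ℕ) < N then
          shiftWire (φ ⟨k, h⟩) (2 + (k : ℕ) * C.gates.length) C.output
        else Sum.inr (κ (k - N))⟩]) (hpreL : pre.length = 2) (i : Fin N)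
    (j : Fin C.gates.length) (hv : 2 + (i : ℕ) * C.gates.length + j < D.gates.length) :
    D.gates[2 + (i : ℕ) * C.gates.length + j] =
      reloc (φ i) (2 + (i : ℕ) * C.gates.length) (C.gates[(j : ℕ)]'j.2) := by
  have hij := blockIndex_lt j.2 i.2
  simp only [hDg]
  rw [List.getElem_append_left (by simp [hpreL]; omega), List.getElem_append_right (by omega)]
  simp only [hpreL, List.getElem_ofFn]
  have e1 : (2 + (i : ℕ) * C.gates.length + (j : ℕ) - 2) = (i : ℕ) * C.gates.length + j := by omega
  have hdm := div_mod_block (k := (i : ℕ)) j.2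
  have hfin : (⟨(2 + (i : ℕ) * C.gates.length + (j : ℕ) - 2) / C.gates.length,
      div_lt_of_lt_mul (by omega)⟩ : Fin N) = i := Fin.ext (by simp only [e1, hdm.1])
  have hmod : (2 + (i : ℕ) * C.gates.length + (j : ℕ) - 2) % C.gates.length = j := by rw [e1, hdm.2]
  have hdiv : (2 + (i : ℕ) * C.gates.length + (j : ℕ) - 2) / C.gates.length = i := by rw [e1, hdm.1]
  rw [hfin]
  simp only [hmod, hdiv]

/-- The final `∨` gate of the layout. -/
theorem layout_getElem_final
    (hDg : D.gates = pre ++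
      (List.ofFn fun v : Fin (N * C.gates.length) =>
        reloc (φ ⟨v / C.gates.length, div_lt_of_lt_mul v.2⟩) (2 + (v / C.gates.length) * C.gates.length)
          (C.gates[(v : ℕ) % C.gates.length]'(mod_lt_of_lt_mul v.2))) ++
      [⟨N + A, op, fun k => if h : (k : ℕ) < N then
          shiftWire (φ ⟨k, h⟩) (2 + (k : ℕ) * C.gates.length) C.output
        else Sum.inr (κ (k - N))⟩]) (hpreL : pre.length = 2)
    (hv : 2 + N * C.gates.length < D.gates.length) :
    D.gates[2 + N * C.gates.length] =
      ⟨N + A, op, fun k => if h : (k : ℕ) < N then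
          shiftWire (φ ⟨k, h⟩) (2 + (k : ℕ) * C.gates.length) C.output
        else Sum.inr (κ (k - N))⟩ := by
  simp only [hDg]
  rw [List.getElem_append_right (by simp [hpreL])]
  simp [hpreL]

end Layout

section Small

/-- `wireVal` (CircuitSemantics) is `wireOf` (GateList). -/
theorem wireVal_eq_wireOf {ι : Type*} (x : ι → Bool) (vs : List Bool) (w : ι ⊕ ℕ) :
    wireVal x vs w = wireOf x vs w := by
  cases w <;> rfl

/-- `GateList.vals` is the transcript. -/
theorem vals_eq_transcript {ι : Type*} (Q : Circuit ι) (x : ι → Bool) :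
    vals Q.gates x = transcript x [] Q.gates := by
  rw [← circuit_wireVals, wireVals_eq_transcript]

end Small

end Monadic

/-- **Registered sub-goal `stub_monadicBlockPerm`** (crux stmt-PneNP-2145, helper of S4): the
block permutation `id₂ ⊕ (π ≀ σ) ⊕ id₁` of the materialisation layout exists
(`Monadic.exists_blockPerm`). -/
theorem stub_monadicBlockPerm : ∀ (N c : ℕ) (π : Equiv.Perm (Fin N)) (σ : Equiv.Perm (Fin c)), ∃ τ : Equiv.Perm (Fin (2 + N * c + 1)), ∀ v : ℕ, Circuit.relabelGate τ v = if v < 2 then v else if v < 2 + N * c then 2 + Circuit.relabelGate π ((v - 2) / c) * c + Circuit.relabelGate σ ((v - 2) % c) else v :=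
  Monadic.exists_blockPerm

end Summit.PneNP.PneNP.Theorems
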